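import Literature.Computability.QuantumComplexity.SimonFourier
import Literature.Computability.QuantumComplexity.ExactQuantumQuery
import HarnessLib

/-!
# Simon's algorithm as a Boolean quantum query algorithm; discharge of `simon_upper`

Family `quantum-advantage` (S10, upper bound). Simon's subroutine Fourier-twice (Simon, FOCS
1994 / SIAM J. Comput. 1997, §3.1) run `k` times in parallel, realised in the tree's Boolean
quantum query model `Literature.Computability.Cryptography.QQueryAlg` on the `n · 2ⁿ`-bit table
of `F : {0,1}ⁿ → {0,1}ⁿ` (`simonInput`, file `QueryComplexity`): "we can also view this problem as
having `n2ⁿ` binary variables that we can query individually … we can simulate one `xᵢ`-query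
using only `n` binary queries" (de Wolf 2019, §3.1). The amplitude combinatorics (`sAmp`,
`MissesBasis`, the two acceptance sums) is file `SimonFourier`; this file supplies the circuit
and the Born-rule bookkeeping, and discharges the named fact
`Literature.Computability.QuantumComplexity.simon_upper` (`simon_upper_holds`, with `C = 3`).

* Registers (`Basis k n`): index `Fin (n · 2ⁿ)`, target qubit, answer registers `a` and query
  registers `z`, both block tuples `Blk k n = (Fin k → Fin n → Bool)`.
* `hadamardZ` — the Hadamard transform on the query registers (`2^{-kn/2} (-1)^{z·y}`, through
  the block characters `chiK` of `SimonFourier`), unitary by `sum_chiK_mul_chiK`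
  (`hadamardZ_mem_unitaryGroup`), with its action `hadamardZ_mulVec`.
* The schedule: query number `q < k · n` reads bit `j` of `F(z_c)`, `(c, j) = slot q`, at table
  position `qIdx i₀ q z = simonIndex n (j, z_c)`; `recAns F q z` are the answer bits recorded
  after `q` queries. Between queries the classical reversible step `stepMap` (an involution:
  swap the target with answer bit `slot q`, swap the index register between the indices of
  queries `q` and `q + 1`) keeps the state equal to `stateFun q = 2^{-kn/2} ∑_z |bst q z⟩`
  (`queryOracle_mulVec_stateFun`, `stepPerm_mulVec`); after the last query the index register
  is parked at `i₀`, so that the final Hadamard layer interferes the blocks: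
  `hadamardZ_mulVec_stateFun` gives the final state `finalFun` with amplitude
  `2^{-kn} sAmp F^k y a` on `|i₀, 0, a, y⟩`.
* `simonAlg n k i₀ : QQueryAlg (n · 2ⁿ)` with `k · n` queries, accepting iff the measured `y`
  satisfies `MissesBasis` (the `k` samples do not contain a basis of `(ℤ/2)ⁿ`);
  `finalState_simonAlg` (by the `Fin.foldl` invariant principle of `PolynomialMethod`),
  `acceptProb_simonAlg = 2^{-2kn} ∑_y ∑_a [MissesBasis y] sAmp²`.
* The two cases (Simon 1994, §3.1): `acceptProb_simonAlg_of_hasXorMask` (probability `1`) and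
  `acceptProb_simonAlg_le_of_injective` (`≤ (2ⁿ-1) 2^{(n-1)k}/2^{kn}`); with `k = n + 2` the
  error is `≤ 1/4 ≤ 1/3` (`errBound_le`, `simonAlg_computesWithError`), whence
  `Q_{1/3}(simonFn n on simonPromise n) ≤ (n + 2) n ≤ 3n² + 3` (`simon_upper_holds`; for `n = 0`
  there is no algorithm on `0` bits and the complexity is the junk value `0`).

Design notes. States are tracked as explicit amplitude functions supported on one basis state
per block tuple `z`, so that the oracle and the permutation steps act by substitution
(`Matrix.permMatrix_mulVec`, `queryOracle_mulVec_apply`) and the involutions are evaluated on a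
single basis state (`queryMap_bst`, `stepMap_ost`, `initMap_base`). The option
`synthInstance.maxSize` is raised for this file: the `DecidableEq` instance term of the nested
basis type exceeds the default cap. Mathlib has no Hadamard transform on `({0,1}ⁿ)ᵏ` or quantum
query algorithms (searched `hadamard`, `walsh`, `query`); reused: `Equiv.swap`,
`Function.Involutive.toPerm`, `Equiv.Perm.permMatrix`, `finProdFinEquiv`, `Matrix.unitaryGroup`.

## References

* D. R. Simon, *On the power of quantum computation*, Proc. 35th FOCS (1994) 116–123, §3.1
  (Routine Fourier-twice; "if `y · s ≡ 0 (mod 2)` … `α(x,y) = 2^{-n+1}`, otherwise `0`"; "if `f`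
  is 1-to-1 … amplitudes will all be `2^{-n}` up to phase"; "the outputs of `n/ε` repetitions of
  Fourier-twice … will with probability `1 - 2^{-ε'(n)}` contain a basis for `(Z₂)ⁿ`") [Simon1994];
  journal version SIAM J. Comput. 26(5) (1997) 1474–1483 [Simon1997].
* R. de Wolf, *Quantum Computing: Lecture Notes*, arXiv:1907.09415, §3.1 (Simon's problem with
  `n2ⁿ` binary variables, one `xᵢ`-query = `n` binary queries), §3.2 (the quantum algorithm)
  [deWolf2019].
* H. Buhrman, R. de Wolf, *Complexity measures and decision tree complexity: a survey*, Theoret.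
  Comput. Sci. 288 (2002), §3 (the source cited by `simon_upper`) [Wolf2002].
-/

namespace Literature.Computability.QuantumComplexity

namespace Simon

open Matrix Finset Literature.Computability.Cryptography

variable {n k : ℕ}

/-! ### The registers -/

/-- A tuple of `k` blocks of `n` bits: the contents of the query registers `z = (z_0, …, z_{k-1})`
(and of the answer registers) of `k` parallel runs of Fourier-twice. [cite: Simon1994, §3.1] -/
abbrev Blk (k n : ℕ) : Type := Fin k → Fin n → Bool

/-- The computational basis of Simon's Boolean query algorithm on the `n · 2ⁿ`-bit table of `F`:
index register `Fin (n · 2ⁿ)`, target qubit, answer registers `a : Blk k n`, query registers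
`z : Blk k n`. [cite: Simon1994, §3.1] -/
abbrev Basis (k n : ℕ) : Type := Fin (n * 2 ^ n) × Bool × Blk k n × Blk k n

-- The `DecidableEq` instance term Mathlib synthesises for the nested basis type `Basis k n`
-- (`Fintype.decidablePiFintype` inside three products) exceeds the default term-size cap 128 of
-- instance synthesis; raise the cap for this file (no new or overriding instance is declared).
set_option synthInstance.maxSize 512

/-- The normalisation `2^{-kn/2}` of the uniform superposition over `({0,1}ⁿ)ᵏ`. [folklore] -/
noncomputable def hnorm (k n : ℕ) : ℝ := (Real.sqrt (2 ^ (k * n)))⁻¹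

/-- `(2^{-kn/2})² = 2^{-kn}`. [folklore] -/
theorem hnorm_mul_self (k n : ℕ) : hnorm k n * hnorm k n = ((2 : ℝ) ^ (k * n))⁻¹ := by
  rw [hnorm, ← mul_inv, Real.mul_self_sqrt (by positivity)]

/-- The block character at the zero tuple is `1`. [folklore] -/
theorem chiK_zero_left (y : Blk k n) : chiK (fun _ _ => false) y = 1 := by
  unfold chiK twist
  simp

/-- Summing a function supported on the fibre `{(i, b, a, ·)}` of the basis over the whole basis.
[folklore] -/
theorem sum_ite_coords (i : Fin (n * 2 ^ n)) (b : Bool) (a : Blk k n) (G : Basis k n → ℂ) :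
    ∑ u : Basis k n, (if u.1 = i ∧ u.2.1 = b ∧ u.2.2.1 = a then G u else 0) =
      ∑ z : Blk k n, G (i, b, a, z) := by
  rw [Fintype.sum_prod_type]
  rw [Finset.sum_eq_single_of_mem i (Finset.mem_univ _) (fun i' _ hi' => by simp [hi'])]
  rw [Fintype.sum_prod_type]
  rw [Finset.sum_eq_single_of_mem b (Finset.mem_univ _) (fun b' _ hb' => by simp [hb'])]
  rw [Fintype.sum_prod_type]
  rw [Finset.sum_eq_single_of_mem a (Finset.mem_univ _) (fun a' _ ha' => by simp [ha'])]
  simp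

/-! ### The Hadamard transform on the query registers -/

/-- The Hadamard transform `H^{⊗ kn}` on the query registers `z`, identity on the index, target
and answer registers: `⟨i,b,a,y| H |i,b,a,z⟩ = 2^{-kn/2} (-1)^{z·y}` (Simon's transformation `F`
applied to all `k` blocks). [cite: Simon1994, §3.1] -/
noncomputable def hadamardZ (k n : ℕ) : Matrix (Basis k n) (Basis k n) ℂ :=
  fun s t => if t.1 = s.1 ∧ t.2.1 = s.2.1 ∧ t.2.2.1 = s.2.2.1 then
    ((hnorm k n * chiK t.2.2.2 s.2.2.2 : ℝ) : ℂ) else 0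

/-- The action of `hadamardZ` on a state vector: a Fourier sum over the query registers.
[cite: Simon1994, §3.1] -/
theorem hadamardZ_mulVec (ψ : Basis k n → ℂ) (s : Basis k n) :
    (hadamardZ k n *ᵥ ψ) s =
      ∑ z : Blk k n, ((hnorm k n * chiK z s.2.2.2 : ℝ) : ℂ) * ψ (s.1, s.2.1, s.2.2.1, z) := by
  simp only [Matrix.mulVec, dotProduct, hadamardZ, ite_mul, zero_mul]
  exact sum_ite_coords s.1 s.2.1 s.2.2.1 _

/-- `hadamardZ` is unitary (orthogonality of the block characters, `sum_chiK_mul_chiK`).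
[cite: Simon1994, §3.1] -/
theorem hadamardZ_mem_unitaryGroup (k n : ℕ) :
    hadamardZ k n ∈ Matrix.unitaryGroup (Basis k n) ℂ := by
  rw [Matrix.mem_unitaryGroup_iff']
  ext s t
  simp only [Matrix.mul_apply, Matrix.star_apply, hadamardZ, Matrix.one_apply]
  have hrw : ∀ u : Basis k n,
      star (if s.1 = u.1 ∧ s.2.1 = u.2.1 ∧ s.2.2.1 = u.2.2.1 then
          ((hnorm k n * chiK s.2.2.2 u.2.2.2 : ℝ) : ℂ) else 0) *
        (if t.1 = u.1 ∧ t.2.1 = u.2.1 ∧ t.2.2.1 = u.2.2.1 then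
          ((hnorm k n * chiK t.2.2.2 u.2.2.2 : ℝ) : ℂ) else 0) =
      if u.1 = s.1 ∧ u.2.1 = s.2.1 ∧ u.2.2.1 = s.2.2.1 then
        (if s.1 = t.1 ∧ s.2.1 = t.2.1 ∧ s.2.2.1 = t.2.2.1 then
          ((hnorm k n * hnorm k n * (chiK s.2.2.2 u.2.2.2 * chiK t.2.2.2 u.2.2.2) : ℝ) : ℂ)
          else 0) else 0 := by
    intro u
    by_cases hu : s.1 = u.1 ∧ s.2.1 = u.2.1 ∧ s.2.2.1 = u.2.2.1
    · have hu' : u.1 = s.1 ∧ u.2.1 = s.2.1 ∧ u.2.2.1 = s.2.2.1 :=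
        ⟨hu.1.symm, hu.2.1.symm, hu.2.2.symm⟩
      rw [if_pos hu, if_pos hu']
      by_cases hst : s.1 = t.1 ∧ s.2.1 = t.2.1 ∧ s.2.2.1 = t.2.2.1
      · have htu : t.1 = u.1 ∧ t.2.1 = u.2.1 ∧ t.2.2.1 = u.2.2.1 :=
          ⟨hst.1.symm.trans hu.1, hst.2.1.symm.trans hu.2.1, hst.2.2.symm.trans hu.2.2⟩
        rw [if_pos hst, if_pos htu, Complex.star_def, Complex.conj_ofReal]
        push_cast
        ring
      · have htu : ¬ (t.1 = u.1 ∧ t.2.1 = u.2.1 ∧ t.2.2.1 = u.2.2.1) := fun h =>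
          hst ⟨hu.1.trans h.1.symm, hu.2.1.trans h.2.1.symm, hu.2.2.trans h.2.2.symm⟩
        rw [if_neg hst, if_neg htu, mul_zero]
    · have hu' : ¬ (u.1 = s.1 ∧ u.2.1 = s.2.1 ∧ u.2.2.1 = s.2.2.1) := fun h =>
        hu ⟨h.1.symm, h.2.1.symm, h.2.2.symm⟩
      rw [if_neg hu, if_neg hu', star_zero, zero_mul]
  simp_rw [hrw]
  rw [sum_ite_coords]
  obtain ⟨i, b, a, y⟩ := s
  obtain ⟨i', b', a', y'⟩ := t
  simp only [Prod.mk.injEq]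
  by_cases h : i = i' ∧ b = b' ∧ a = a'
  · simp only [h, and_self, if_true, true_and]
    rw [← Complex.ofReal_sum, ← Finset.mul_sum, sum_chiK_mul_chiK]
    split_ifs with hy
    · rw [hnorm_mul_self, inv_mul_cancel₀ (by positivity)]
      simp
    · simp
  · have h0 : ¬ (i = i' ∧ b = b' ∧ a = a' ∧ y = y') := fun h' => h ⟨h'.1, h'.2.1, h'.2.2.1⟩
    simp only [h, if_false, Finset.sum_const_zero, h0]

/-! ### The query schedule and the recorded answers -/

/-- The slot `(c, j)` — block `c`, bit position `j` — served by query number `q < k · n`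
(queries are numbered by `finProdFinEquiv`). [folklore] -/
def slot (q : Fin (k * n)) : Fin k × Fin n := finProdFinEquiv.symm q

/-- The table index queried by query number `q` on the block tuple `z`: the position
`simonIndex n (j, z_c)` of bit `j` of `F(z_c)`, where `(c, j) = slot q`; after the last query
(`q ≥ k · n`) the index register is parked at the fixed index `i₀`. [cite: deWolf2019, §3.1] -/
def qIdx (i₀ : Fin (n * 2 ^ n)) (q : ℕ) (z : Blk k n) : Fin (n * 2 ^ n) :=
  if h : q < k * n then
    simonIndex n ((slot (k := k) (n := n) ⟨q, h⟩).2, z (slot (k := k) (n := n) ⟨q, h⟩).1)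
  else i₀

/-- The contents of the answer registers after `q` queries on (the table of) `F`: answer bit
`(c, j)` holds `F(z_c)_j` if its query number is `< q` and is still `0` otherwise.
[cite: Simon1994, §3.1] -/
def recAns (F : (Fin n → Bool) → Fin n → Bool) (q : ℕ) (z : Blk k n) : Blk k n :=
  fun c j => decide (((finProdFinEquiv (c, j) : Fin (k * n)) : ℕ) < q) && F (z c) j

/-- Writing the value `v` into bit `(c, j)` of a block tuple. [folklore] -/
def set2 (a : Blk k n) (c : Fin k) (j : Fin n) (v : Bool) : Blk k n :=
  Function.update a c (Function.update (a c) j v)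

/-- Reading back the written bit. [folklore] -/
@[simp] theorem set2_apply_same (a : Blk k n) (c : Fin k) (j : Fin n) (v : Bool) :
    set2 a c j v c j = v := by
  simp [set2]

/-- Writing twice into the same bit. [folklore] -/
theorem set2_set2 (a : Blk k n) (c : Fin k) (j : Fin n) (v w : Bool) :
    set2 (set2 a c j v) c j w = set2 a c j w := by
  unfold set2
  simp

/-- Writing the old value changes nothing. [folklore] -/
theorem set2_eq_self (a : Blk k n) (c : Fin k) (j : Fin n) : set2 a c j (a c j) = a := by
  unfold set2
  simp

/-- Writing into bit `(c, j)` does not change the other bits. [folklore] -/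
theorem set2_apply_of_ne (a : Blk k n) {c c' : Fin k} {j j' : Fin n} (h : (c', j') ≠ (c, j))
    (v : Bool) : set2 a c j v c' j' = a c' j' := by
  unfold set2
  by_cases hc : c' = c
  · subst hc
    have hj : j' ≠ j := fun hj => h (by rw [hj])
    simp [Function.update_of_ne hj]
  · simp [Function.update_of_ne hc]

/-- Before any query the answer registers are empty. [folklore] -/
theorem recAns_zero (F : (Fin n → Bool) → Fin n → Bool) (z : Blk k n) :
    recAns F 0 z = fun _ _ => false := by
  funext c j
  simp [recAns]

/-- After all `k · n` queries the answer registers hold `(F(z_0), …, F(z_{k-1}))`.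
[cite: Simon1994, §3.1] -/
theorem recAns_all (F : (Fin n → Bool) → Fin n → Bool) (z : Blk k n) :
    recAns F (k * n) z = fun c => F (z c) := by
  funext c j
  have h := (finProdFinEquiv (c, j) : Fin (k * n)).isLt
  simp only [recAns, h, decide_true, Bool.true_and]

/-- Before query `q` the answer bit `slot q` is still `0`. [folklore] -/
theorem recAns_slot (F : (Fin n → Bool) → Fin n → Bool) (q : Fin (k * n)) (z : Blk k n) :
    recAns F q z (slot q).1 (slot q).2 = false := by
  simp only [recAns, slot, Prod.mk.eta, Equiv.apply_symm_apply, lt_self_iff_false, decide_false,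
    Bool.false_and]

/-- Query `q` writes `F(z_c)_j` into answer bit `(c, j) = slot q`. [cite: Simon1994, §3.1] -/
theorem recAns_succ (F : (Fin n → Bool) → Fin n → Bool) (q : Fin (k * n)) (z : Blk k n) :
    recAns F ((q : ℕ) + 1) z =
      set2 (recAns F q z) (slot q).1 (slot q).2 (F (z (slot q).1) (slot q).2) := by
  funext c' j'
  by_cases h : (c', j') = ((slot q).1, (slot q).2)
  · obtain ⟨rfl, rfl⟩ := Prod.mk.injEq _ _ _ _ ▸ h
    rw [set2_apply_same]
    simp only [recAns, slot, Prod.mk.eta, Equiv.apply_symm_apply, Nat.lt_add_one, decide_true,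
      Bool.true_and]
  · rw [set2_apply_of_ne _ h]
    have hne : ((finProdFinEquiv (c', j') : Fin (k * n)) : ℕ) ≠ q := by
      intro hq
      apply h
      have : finProdFinEquiv (c', j') = q := Fin.ext hq
      rw [slot, ← this, Equiv.symm_apply_apply]
    have hiff : ((finProdFinEquiv (c', j') : Fin (k * n)) : ℕ) < (q : ℕ) + 1 ↔
        ((finProdFinEquiv (c', j') : Fin (k * n)) : ℕ) < q := by omega
    simp only [recAns, hiff]

/-- The index of query `q < k · n`. [folklore] -/
theorem qIdx_of_lt (i₀ : Fin (n * 2 ^ n)) {q : ℕ} (h : q < k * n) (z : Blk k n) :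
    qIdx i₀ q z = simonIndex n ((slot (k := k) (n := n) ⟨q, h⟩).2,
      z (slot (k := k) (n := n) ⟨q, h⟩).1) :=
  dif_pos h

/-- After the last query the index register is parked at `i₀`. [folklore] -/
theorem qIdx_all (i₀ : Fin (n * 2 ^ n)) (z : Blk k n) : qIdx (k := k) i₀ (k * n) z = i₀ :=
  dif_neg (lt_irrefl _)

/-- The table bit at the index of query `q` is `F(z_c)_j`, `(c, j) = slot q` (one Boolean query
reads one bit of one value of `F`). [cite: deWolf2019, §3.1] -/
theorem simonInput_qIdx (i₀ : Fin (n * 2 ^ n)) (F : (Fin n → Bool) → Fin n → Bool)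
    (q : Fin (k * n)) (z : Blk k n) :
    simonInput n F (qIdx i₀ q z) = F (z (slot q).1) (slot q).2 := by
  rw [qIdx_of_lt i₀ q.isLt, Fin.eta]
  simp [simonInput]

/-! ### The basis states carrying the amplitude, and the classical (permutation) steps -/

/-- The basis state of block tuple `z` after `q` queries: index register at the index of query
`q`, target `0`, answers recorded so far, query registers `z`. [cite: Simon1994, §3.1] -/
def bst (i₀ : Fin (n * 2 ^ n)) (F : (Fin n → Bool) → Fin n → Bool) (q : ℕ) (z : Blk k n) :
    Basis k n :=
  (qIdx i₀ q z, false, recAns F q z, z)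

/-- The basis state of block tuple `z` right after the oracle call of query `q`: the target holds
the answer bit `F(z_c)_j`. [cite: Simon1994, §3.1] -/
def ost (i₀ : Fin (n * 2 ^ n)) (F : (Fin n → Bool) → Fin n → Bool) (q : Fin (k * n))
    (z : Blk k n) : Basis k n :=
  (qIdx i₀ q z, F (z (slot q).1) (slot q).2, recAns F q z, z)

/-- The oracle maps `bst q z` to `ost q z` (it xors `F(z_c)_j` into the cleared target).
[cite: Simon1994, §3.1] -/
theorem queryMap_bst (i₀ : Fin (n * 2 ^ n)) (F : (Fin n → Bool) → Fin n → Bool)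
    (q : Fin (k * n)) (z : Blk k n) :
    queryMap (simonInput n F) (bst i₀ F q z) = ost i₀ F q z := by
  simp only [queryMap_apply, bst, ost, simonInput_qIdx, Bool.false_xor]

/-- The classical step after query `q`: swap the target with answer bit `slot q` and move the
index register from the index of query `q` to that of query `q + 1` (two commuting
involutions; "the computation of `(x, f(x))` … can always be made reversible").
[cite: Simon1994, §3.1] -/
def stepMap (i₀ : Fin (n * 2 ^ n)) (q : Fin (k * n)) (s : Basis k n) : Basis k n :=
  (Equiv.swap (qIdx i₀ q s.2.2.2) (qIdx i₀ ((q : ℕ) + 1) s.2.2.2) s.1,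
    s.2.2.1 (slot q).1 (slot q).2, set2 s.2.2.1 (slot q).1 (slot q).2 s.2.1, s.2.2.2)

/-- The classical step is an involution. [folklore] -/
theorem stepMap_involutive (i₀ : Fin (n * 2 ^ n)) (q : Fin (k * n)) :
    Function.Involutive (stepMap i₀ q) := by
  rintro ⟨i, b, a, z⟩
  simp [stepMap, set2_set2, set2_eq_self, Equiv.swap_apply_self]

/-- The classical step as a permutation of the basis. [folklore] -/
def stepPerm (i₀ : Fin (n * 2 ^ n)) (q : Fin (k * n)) : Equiv.Perm (Basis k n) :=
  Function.Involutive.toPerm _ (stepMap_involutive i₀ q)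

/-- `stepPerm` acts as `stepMap`. [folklore] -/
@[simp] theorem stepPerm_apply (i₀ : Fin (n * 2 ^ n)) (q : Fin (k * n)) (s : Basis k n) :
    stepPerm i₀ q s = stepMap i₀ q s := rfl

/-- The classical step maps `ost q z` to `bst (q+1) z`. [cite: Simon1994, §3.1] -/
theorem stepMap_ost (i₀ : Fin (n * 2 ^ n)) (F : (Fin n → Bool) → Fin n → Bool)
    (q : Fin (k * n)) (z : Blk k n) :
    stepMap i₀ q (ost i₀ F q z) = bst i₀ F ((q : ℕ) + 1) z := by
  simp only [stepMap, ost, bst, Equiv.swap_apply_left, recAns_slot, recAns_succ]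

/-- The initial classical step: move the index register from `i₀` to the index of query `0`.
[folklore] -/
def initMap (i₀ : Fin (n * 2 ^ n)) (s : Basis k n) : Basis k n :=
  (Equiv.swap i₀ (qIdx (k := k) i₀ 0 s.2.2.2) s.1, s.2.1, s.2.2.1, s.2.2.2)

/-- The initial classical step is an involution. [folklore] -/
theorem initMap_involutive (i₀ : Fin (n * 2 ^ n)) :
    Function.Involutive (initMap (k := k) i₀) := by
  rintro ⟨i, b, a, z⟩
  simp [initMap, Equiv.swap_apply_self]

/-- The initial classical step as a permutation of the basis. [folklore] -/
def initPerm (i₀ : Fin (n * 2 ^ n)) : Equiv.Perm (Basis k n) :=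
  Function.Involutive.toPerm _ (initMap_involutive i₀)

/-- `initPerm` acts as `initMap`. [folklore] -/
@[simp] theorem initPerm_apply (i₀ : Fin (n * 2 ^ n)) (s : Basis k n) :
    initPerm i₀ s = initMap i₀ s := rfl

/-- The initial classical step maps `|i₀, 0, 0, z⟩` to `bst 0 z`. [folklore] -/
theorem initMap_base (i₀ : Fin (n * 2 ^ n)) (F : (Fin n → Bool) → Fin n → Bool) (z : Blk k n) :
    initMap i₀ (i₀, false, (fun _ _ => false), z) = bst i₀ F 0 z := by
  simp only [initMap, bst, Equiv.swap_apply_left, recAns_zero]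

/-! ### The states of the computation -/

/-- The state after `q ≤ k · n` queries (before the final Hadamard layer): the uniform
superposition `2^{-kn/2} ∑_z |bst q z⟩` ("`2^{-n/2} ∑_x |x⟩ |f(x)⟩`" in each block).
[cite: Simon1994, §3.1] -/
noncomputable def stateFun (i₀ : Fin (n * 2 ^ n)) (F : (Fin n → Bool) → Fin n → Bool) (q : ℕ) :
    Basis k n → ℂ :=
  fun s => if s = bst i₀ F q s.2.2.2 then (hnorm k n : ℂ) else 0

/-- The state right after the oracle call of query `q`. [cite: Simon1994, §3.1] -/
noncomputable def ostateFun (i₀ : Fin (n * 2 ^ n)) (F : (Fin n → Bool) → Fin n → Bool)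
    (q : Fin (k * n)) : Basis k n → ℂ :=
  fun s => if s = ost i₀ F q s.2.2.2 then (hnorm k n : ℂ) else 0

/-- The final state: amplitude `2^{-kn} ∑_{z : F^k(z) = a} (-1)^{z·y}` on `|i₀, 0, a, y⟩`
(Simon's "the amplitude of this configuration will be `2^{-n} ∑ (-1)^{z·y}`", in all `k` blocks),
in terms of `sAmp` of file `SimonFourier`. [cite: Simon1994, §3.1] -/
noncomputable def finalFun (i₀ : Fin (n * 2 ^ n)) (F : (Fin n → Bool) → Fin n → Bool) :
    Basis k n → ℂ :=
  fun s => if s.1 = i₀ ∧ s.2.1 = false then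
    ((hnorm k n * hnorm k n * sAmp (fun z c => F (z c)) s.2.2.2 s.2.2.1 : ℝ) : ℂ) else 0

/-- The first Hadamard layer on `|i₀, 0, 0, 0⟩` gives `2^{-kn/2} ∑_z |i₀, 0, 0, z⟩`.
[cite: Simon1994, §3.1] -/
theorem hadamardZ_mulVec_single (i₀ : Fin (n * 2 ^ n)) :
    hadamardZ k n *ᵥ Pi.single (i₀, false, (fun _ _ => false), (fun _ _ => false)) 1 =
      fun s => if s = (i₀, false, (fun _ _ => false), s.2.2.2) then (hnorm k n : ℂ) else 0 := by
  funext s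
  rw [hadamardZ_mulVec]
  obtain ⟨i, b, a, z⟩ := s
  simp only [Pi.single_apply, Prod.mk.injEq, and_true, mul_ite, mul_one, mul_zero]
  by_cases hc : i = i₀ ∧ b = false ∧ a = fun _ _ => false
  · simp only [hc, true_and, if_true]
    rw [Finset.sum_ite_eq']
    simp [chiK_zero_left]
  · rw [if_neg hc]
    exact Finset.sum_eq_zero fun z' _ => if_neg fun h => hc ⟨h.1, h.2.1, h.2.2.1⟩

/-- The initial unitary (Hadamard layer, then the initial classical step) prepares `stateFun 0`.
[cite: Simon1994, §3.1] -/
theorem initPerm_mulVec (i₀ : Fin (n * 2 ^ n)) (F : (Fin n → Bool) → Fin n → Bool) :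
    (initPerm (k := k) i₀).permMatrix ℂ *ᵥ
        (hadamardZ k n *ᵥ Pi.single (i₀, false, (fun _ _ => false), (fun _ _ => false)) 1) =
      stateFun i₀ F 0 := by
  rw [hadamardZ_mulVec_single]
  funext s
  rw [Matrix.permMatrix_mulVec, Function.comp_apply, initPerm_apply]
  have hz : (initMap i₀ s).2.2.2 = s.2.2.2 := rfl
  simp only [stateFun, hz]
  exact if_congr ((initMap_involutive i₀).eq_iff.trans (by rw [initMap_base i₀ F])) rfl rfl

/-- The oracle call of query `q` maps `stateFun q` to `ostateFun q`. [cite: Simon1994, §3.1] -/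
theorem queryOracle_mulVec_stateFun (i₀ : Fin (n * 2 ^ n)) (F : (Fin n → Bool) → Fin n → Bool)
    (q : Fin (k * n)) :
    queryOracle (simonInput n F) *ᵥ stateFun i₀ F q = ostateFun i₀ F q := by
  funext s
  rw [queryOracle_mulVec_apply]
  change (if queryMap (simonInput n F) s = bst i₀ F q s.2.2.2 then (hnorm k n : ℂ) else 0) =
    if s = ost i₀ F q s.2.2.2 then (hnorm k n : ℂ) else 0
  exact if_congr ((queryMap_involutive _).eq_iff.trans (by rw [queryMap_bst])) rfl rfl

/-- The classical step after query `q` maps `ostateFun q` to `stateFun (q + 1)`.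
[cite: Simon1994, §3.1] -/
theorem stepPerm_mulVec (i₀ : Fin (n * 2 ^ n)) (F : (Fin n → Bool) → Fin n → Bool)
    (q : Fin (k * n)) :
    (stepPerm i₀ q).permMatrix ℂ *ᵥ ostateFun i₀ F q = stateFun i₀ F ((q : ℕ) + 1) := by
  funext s
  rw [Matrix.permMatrix_mulVec, Function.comp_apply, stepPerm_apply]
  have hz : (stepMap i₀ q s).2.2.2 = s.2.2.2 := rfl
  simp only [stateFun, ostateFun, hz]
  exact if_congr ((stepMap_involutive i₀ q).eq_iff.trans (by rw [stepMap_ost])) rfl rfl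

/-- The final Hadamard layer turns `stateFun (k n) = 2^{-kn/2} ∑_z |i₀, 0, F^k(z), z⟩` into the
Fourier-sampling state `finalFun`. [cite: Simon1994, §3.1] -/
theorem hadamardZ_mulVec_stateFun (i₀ : Fin (n * 2 ^ n)) (F : (Fin n → Bool) → Fin n → Bool) :
    hadamardZ k n *ᵥ stateFun i₀ F (k * n) = finalFun i₀ F := by
  funext s
  rw [hadamardZ_mulVec]
  obtain ⟨i, b, a, y⟩ := s
  simp only [stateFun, finalFun, bst, qIdx_all, recAns_all, Prod.mk.injEq, and_true]
  by_cases hc : i = i₀ ∧ b = false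
  · rw [if_pos hc]
    simp only [hc, true_and, sAmp]
    rw [Complex.ofReal_mul, Complex.ofReal_sum, Finset.mul_sum]
    refine Finset.sum_congr rfl fun z _ => ?_
    by_cases hz : a = fun c => F (z c)
    · rw [if_pos hz, if_pos hz.symm]
      push_cast
      ring
    · rw [if_neg hz, if_neg (fun h => hz h.symm)]
      simp
  · rw [if_neg hc]
    exact Finset.sum_eq_zero fun z _ => by rw [if_neg (fun h => hc ⟨h.1, h.2.1⟩), mul_zero]

/-! ### The algorithm -/

/-- The Hadamard layer as an element of the unitary group. [cite: Simon1994, §3.1] -/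
noncomputable def hadU (k n : ℕ) : Matrix.unitaryGroup (Basis k n) ℂ :=
  ⟨hadamardZ k n, hadamardZ_mem_unitaryGroup k n⟩

/-- `U₀`: the Hadamard layer followed by the initial classical step. [cite: Simon1994, §3.1] -/
noncomputable def initU (i₀ : Fin (n * 2 ^ n)) : Matrix.unitaryGroup (Basis k n) ℂ :=
  ⟨(initPerm i₀).permMatrix ℂ, permMatrix_mem_unitaryGroup _⟩ * hadU k n

/-- `U_{q+1}`: the classical step after query `q`, followed — after the last query only — by the
final Hadamard layer. [cite: Simon1994, §3.1] -/
noncomputable def stepU (i₀ : Fin (n * 2 ^ n)) (q : Fin (k * n)) :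
    Matrix.unitaryGroup (Basis k n) ℂ :=
  if (q : ℕ) + 1 = k * n then
    hadU k n * ⟨(stepPerm i₀ q).permMatrix ℂ, permMatrix_mem_unitaryGroup _⟩
  else ⟨(stepPerm i₀ q).permMatrix ℂ, permMatrix_mem_unitaryGroup _⟩

/-- **Simon's algorithm as a Boolean quantum query algorithm** on the `n · 2ⁿ`-bit table of
`F : {0,1}ⁿ → {0,1}ⁿ` (`k` parallel runs of Fourier-twice, each value `F(z_c)` read with `n`
Boolean queries, `k · n` queries in all; accept iff the `k` samples do not contain a basis of
`(ℤ/2)ⁿ`, `MissesBasis`). Workspace: answer registers and query registers `Blk k n × Blk k n`;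
`i₀` is the parking position of the index register. Reducible, so that the fields unfold in
instance search. [cite: Simon1994, §3.1] [cite: deWolf2019, §3.1–§3.2] -/
@[reducible] noncomputable def simonAlg (n k : ℕ) (i₀ : Fin (n * 2 ^ n)) :
    QQueryAlg (n * 2 ^ n) where
  W := Blk k n × Blk k n
  queries := k * n
  unitaries := fun j =>
    Fin.cases (motive := fun _ => Matrix.unitaryGroup (Basis k n) ℂ) (initU i₀)
      (fun q => stepU i₀ q) j
  start := (i₀, false, (fun _ _ => false), (fun _ _ => false))
  accept := {s | MissesBasis s.2.2.2}

/-- The final state of Simon's algorithm on the table of `F` is the Fourier-sampling state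
`finalFun` (for `k · n ≥ 1`). [cite: Simon1994, §3.1] -/
theorem finalState_simonAlg (i₀ : Fin (n * 2 ^ n)) (F : (Fin n → Bool) → Fin n → Bool)
    (hkn : 0 < k * n) :
    (simonAlg n k i₀).finalState (simonInput n F) = finalFun i₀ F := by
  unfold QQueryAlg.finalState
  refine (foldl_invariant (P := fun (q : ℕ) (ψ : Basis k n → ℂ) =>
      (q < k * n → ψ = stateFun i₀ F q) ∧ (q = k * n → ψ = finalFun i₀ F))
    (simonAlg n k i₀).queries
    (fun ψ j => ((simonAlg n k i₀).unitaries j.succ).1 *ᵥ (queryOracle (simonInput n F) *ᵥ ψ))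
    (((simonAlg n k i₀).unitaries 0).1 *ᵥ Pi.single (simonAlg n k i₀).start 1) ?_ ?_).2 rfl
  · refine ⟨fun _ => ?_, fun h => absurd h hkn.ne⟩
    show ((initU i₀ : Matrix.unitaryGroup (Basis k n) ℂ).1) *ᵥ _ = _
    rw [initU, Submonoid.coe_mul, ← Matrix.mulVec_mulVec]
    exact initPerm_mulVec i₀ F
  · intro j ψ hψ
    rw [hψ.1 j.isLt]
    show (fun q => (q < k * n → (stepU i₀ j).1 *ᵥ _ = _) ∧ (q = k * n → (stepU i₀ j).1 *ᵥ _ = _))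
      ((j : ℕ) + 1)
    simp only [queryOracle_mulVec_stateFun]
    by_cases hlast : (j : ℕ) + 1 = k * n
    · refine ⟨fun h => absurd hlast h.ne, fun _ => ?_⟩
      rw [stepU, if_pos hlast, Submonoid.coe_mul, ← Matrix.mulVec_mulVec, stepPerm_mulVec, hlast]
      exact hadamardZ_mulVec_stateFun i₀ F
    · refine ⟨fun _ => ?_, fun h => absurd h hlast⟩
      rw [stepU, if_neg hlast]
      exact stepPerm_mulVec i₀ F j

/-! ### The acceptance probability and the two cases of Simon's analysis -/

/-- **The acceptance probability of Simon's algorithm**: `2^{-2kn} ∑_{y accepted} ∑_a sAmp²`,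
the Born probability of measuring query registers `y` with `MissesBasis y`.
[cite: Simon1994, §3.1] -/
theorem acceptProb_simonAlg (i₀ : Fin (n * 2 ^ n)) (F : (Fin n → Bool) → Fin n → Bool)
    (hkn : 0 < k * n) :
    (simonAlg n k i₀).acceptProb (simonInput n F) =
      (hnorm k n * hnorm k n) ^ 2 *
        ∑ y : Blk k n, ∑ a : Blk k n,
          if MissesBasis y then sAmp (fun z c => F (z c)) y a ^ 2 else 0 := by
  classical
  unfold QQueryAlg.acceptProb
  rw [finalState_simonAlg i₀ F hkn, Finset.sum_filter]
  have hvan : ∀ (s : Basis k n) (d : Decidable (s ∈ (simonAlg n k i₀).accept)),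
      ¬ (s.1 = i₀ ∧ s.2.1 = false) →
        @ite _ (s ∈ (simonAlg n k i₀).accept) d (‖finalFun i₀ F s‖ ^ 2) 0 = 0 := by
    intro s d hs
    rw [show finalFun i₀ F s = 0 from if_neg hs]
    simp
  rw [Fintype.sum_prod_type, Finset.sum_eq_single_of_mem i₀ (Finset.mem_univ _)]
  swap
  · intro i _ hi
    exact Finset.sum_eq_zero fun r _ => hvan _ _ (fun h => hi h.1)
  rw [Fintype.sum_prod_type, Finset.sum_eq_single_of_mem false (Finset.mem_univ _)]
  swap
  · intro b _ hb
    exact Finset.sum_eq_zero fun r _ => hvan _ _ (fun h => hb h.2)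
  rw [Fintype.sum_prod_type, Finset.sum_comm, Finset.mul_sum]
  refine Finset.sum_congr rfl fun y _ => ?_
  rw [Finset.mul_sum]
  refine Finset.sum_congr rfl fun a _ => ?_
  simp only [finalFun, true_and, if_true]
  split_ifs with h1 h2 h2
  · rw [Complex.norm_real, Real.norm_eq_abs, sq_abs]
    ring
  · exact absurd h1 h2
  · exact absurd h2 h1
  · rw [mul_zero]

/-- Post-composing the blocks with `F` is injective when `F` is. [folklore] -/
theorem injective_blocks {F : (Fin n → Bool) → Fin n → Bool} (hF : Function.Injective F) :
    Function.Injective (fun (z : Blk k n) (c : Fin k) => F (z c)) :=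
  fun _ _ h => funext fun c => hF (congrFun h c)

/-- A xor-mask of `F` is a period of every block of `z ↦ (F(z_0), …, F(z_{k-1}))`.
[cite: Simon1994, §3.1] -/
theorem periodic_blocks {F : (Fin n → Bool) → Fin n → Bool} {s : Fin n → Bool}
    (hF : HasXorMask F s) (z : Blk k n) (c : Fin k) :
    (fun c' => F (Function.update z c (fun i => z c i ^^ s i) c')) = fun c' => F (z c') := by
  funext c'
  by_cases hc : c' = c
  · subst hc
    rw [Function.update_self, hF.apply_xor]
  · rw [Function.update_of_ne hc]

/-- **The periodic case**: if `F` has a nonzero xor-mask, Simon's algorithm accepts with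
probability `1` ("`k` independent repetitions of Fourier-twice will yield `k` configurations …
such that `y · s ≡ 0`"). [cite: Simon1994, §3.1] -/
theorem acceptProb_simonAlg_of_hasXorMask (i₀ : Fin (n * 2 ^ n)) (hkn : 0 < k * n)
    {F : (Fin n → Bool) → Fin n → Bool} {s : Fin n → Bool} (hs : s ≠ fun _ => false)
    (hF : HasXorMask F s) :
    (simonAlg n k i₀).acceptProb (simonInput n F) = 1 := by
  rw [acceptProb_simonAlg i₀ F hkn,
    sum_missesBasis_sAmp_sq_of_periodic hs (fun z c => periodic_blocks hF z c), hnorm_mul_self]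
  have h2 : (2 : ℝ) ^ (k * n) ≠ 0 := by positivity
  field_simp

/-- **The injective case**: if `F` is injective, Simon's algorithm accepts with probability at
most `(2ⁿ - 1) · 2^{(n-1)k} / 2^{kn}` (the union bound over the `2ⁿ - 1` hyperplanes, "will with
probability `1 - 2^{…}` contain a basis"). [cite: Simon1994, §3.1] -/
theorem acceptProb_simonAlg_le_of_injective (i₀ : Fin (n * 2 ^ n)) (hkn : 0 < k * n)
    {F : (Fin n → Bool) → Fin n → Bool} (hF : Function.Injective F) :
    (simonAlg n k i₀).acceptProb (simonInput n F) ≤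
      (((2 ^ n - 1) * 2 ^ ((n - 1) * k) : ℕ) : ℝ) / 2 ^ (k * n) := by
  rw [acceptProb_simonAlg i₀ F hkn, hnorm_mul_self]
  have h := sum_missesBasis_sAmp_sq_of_injective (injective_blocks (k := k) hF)
  have h2 : (0 : ℝ) < 2 ^ (k * n) := by positivity
  calc ((2 : ℝ) ^ (k * n))⁻¹ ^ 2 *
        ∑ y : Blk k n, ∑ a : Blk k n,
          (if MissesBasis y then sAmp (fun z c => F (z c)) y a ^ 2 else 0)
      ≤ ((2 : ℝ) ^ (k * n))⁻¹ ^ 2 *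
          ((2 : ℝ) ^ (k * n) * (((2 ^ n - 1) * 2 ^ ((n - 1) * k) : ℕ) : ℝ)) :=
        mul_le_mul_of_nonneg_left h (by positivity)
    _ = (((2 ^ n - 1) * 2 ^ ((n - 1) * k) : ℕ) : ℝ) / 2 ^ (k * n) := by
        field_simp

/-- The error bound of `n + 2` parallel runs in the injective case:
`(2ⁿ - 1) 2^{(n-1)(n+2)} / 2^{(n+2)n} = (2ⁿ - 1)/2^{n+2} ≤ 1/3` (here `n = m + 1 ≥ 1`). [folklore] -/
theorem errBound_le (m : ℕ) :
    (((2 ^ (m + 1) - 1) * 2 ^ ((m + 1 - 1) * (m + 1 + 2)) : ℕ) : ℝ) /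
        2 ^ ((m + 1 + 2) * (m + 1)) ≤ 1 / 3 := by
  have hexp : (m + 1 + 2) * (m + 1) = (m + 1 - 1) * (m + 1 + 2) + (m + 1) + 2 := by
    rw [Nat.add_sub_cancel]
    ring
  have hcast : (((2 ^ (m + 1) - 1) * 2 ^ ((m + 1 - 1) * (m + 1 + 2)) : ℕ) : ℝ) =
      ((2 : ℝ) ^ (m + 1) - 1) * 2 ^ ((m + 1 - 1) * (m + 1 + 2)) := by
    rw [Nat.cast_mul, Nat.cast_pow, Nat.cast_sub Nat.one_le_two_pow]
    push_cast
    ring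
  have hpow : (2 : ℝ) ^ ((m + 1 + 2) * (m + 1)) =
      2 ^ ((m + 1 - 1) * (m + 1 + 2)) * 2 ^ (m + 1) * 4 := by
    rw [hexp, pow_add, pow_add]
    norm_num
  rw [hcast, hpow, div_le_iff₀ (by positivity)]
  have hB : (0 : ℝ) < 2 ^ ((m + 1 - 1) * (m + 1 + 2)) := by positivity
  have hAB : (0 : ℝ) ≤ 2 ^ ((m + 1 - 1) * (m + 1 + 2)) * 2 ^ (m + 1) := by positivity
  nlinarith [hB, hAB]

/-- **Simon's algorithm solves Simon's promise problem with bounded error**: with `k = n + 2`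
parallel runs (`(n + 2) · n` Boolean queries) it computes `simonFn n` with error `≤ 1/3` on the
promise set, for `n ≥ 1`: a masked `F` is accepted with probability `1`, an injective `F` with
probability `≤ 1/4`. [cite: Simon1994, §3.1] [cite: deWolf2019, §3.2] -/
theorem simonAlg_computesWithError (hn : 1 ≤ n) (i₀ : Fin (n * 2 ^ n)) :
    (simonAlg n (n + 2) i₀).ComputesWithError (1 / 3) (simonPromise n) (simonFn n) := by
  intro t ht
  obtain ⟨F, rfl⟩ : ∃ F, t = simonInput n F := ⟨simonDecode n t, (simonInput_simonDecode t).symm⟩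
  rw [simonInput_mem_simonPromise_iff] at ht
  have hkn : 0 < (n + 2) * n := Nat.mul_pos (by omega) hn
  constructor
  · intro htrue
    simp only [simonFn, simonDecode_simonInput, decide_eq_true_eq] at htrue
    obtain ⟨s, hs, hmask⟩ := htrue
    rw [acceptProb_simonAlg_of_hasXorMask i₀ hkn hs hmask]
    norm_num
  · intro hfalse
    simp only [simonFn, simonDecode_simonInput, decide_eq_false_iff_not] at hfalse
    have hinj : Function.Injective F := ht.resolve_right hfalse
    refine (acceptProb_simonAlg_le_of_injective i₀ hkn hinj).trans ?_
    obtain ⟨m, rfl⟩ : ∃ m, n = m + 1 := ⟨n - 1, by omega⟩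
    exact errBound_le m

end Simon

/-! ### Discharge of `simon_upper` -/

open Cryptography in
/-- **quantum-advantage.S10, upper bound, discharged** (Simon, FOCS 1994 / SIAM J. Comput.
1997, §3.1; de Wolf 2019, §3.1–§3.2; cited by Buhrman–de Wolf 2002, §3): Simon's promise problem
has bounded-error quantum query complexity at most `(n + 2) · n ≤ 3 n² + 3` in the Boolean query
model (`n + 2` parallel runs of Fourier-twice, each `F`-value read with `n` Boolean queries), so
the named fact `simon_upper` holds with `C = 3`. For `n = 0` there is no query algorithm on `0`
bits and the complexity is the junk value `0`. [cite: Simon1994, §3.1] [cite: deWolf2019, §3.2] -/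
theorem simon_upper_holds : simon_upper := by
  refine ⟨3, fun n => ?_⟩
  rcases Nat.eq_zero_or_pos n with rfl | hn
  · have h0 : quantumQueryComplexityOn (1 / 3) (simonPromise 0) (simonFn 0) = 0 := by
      have he : {T | ∃ A : QQueryAlg (0 * 2 ^ 0), A.queries = T ∧
          A.ComputesWithError (1 / 3) (simonPromise 0) (simonFn 0)} = ∅ :=
        Set.eq_empty_of_forall_notMem fun _ ⟨A, _, _⟩ => by
          have h := A.start.1.isLt
          simp at h
      rw [quantumQueryComplexityOn, he, Nat.sInf_empty]
    rw [h0]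
    norm_num
  · have i₀ : Fin (n * 2 ^ n) := ⟨0, Nat.mul_pos hn (Nat.two_pow_pos n)⟩
    have hle : quantumQueryComplexityOn (1 / 3) (simonPromise n) (simonFn n) ≤ (n + 2) * n :=
      Nat.sInf_le ⟨Simon.simonAlg n (n + 2) i₀, rfl, Simon.simonAlg_computesWithError hn i₀⟩
    calc (quantumQueryComplexityOn (1 / 3) (simonPromise n) (simonFn n) : ℝ)
        ≤ (((n + 2) * n : ℕ) : ℝ) := by exact_mod_cast hle
      _ ≤ 3 * (n : ℝ) ^ 2 + 3 := by
        push_cast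
        nlinarith [sq_nonneg ((n : ℝ) - 1)]

end Literature.Computability.QuantumComplexity
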